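import Summits.Langlands.Langlands.Theorems.ParityBlindBianchiArtinWeightRealisationEvenStubTwistConjugateNormalForm
import HarnessLib

/-!
# Stub `stub_twistOfAdNormalForm` (S4ad-twist) of the line `SketchIdeator2` for the crux
# `ParityBlindBianchi.ArtinWeightRealisationEven` (item stmt-Langlands-16619)

Helper file (`--supports stmt-Langlands-16619`): the GENERAL-SCALAR version of E4–E5
(`TwistConjugate.same_or_flip`, `TwistConjugate.exists_twist_of_normal_form`).  For homomorphisms
`σ r : Γ → GL₂(A)`, `A` an algebraically closed field, satisfying the ADJOINT TRACE IDENTITY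
`tr(r g)² · det σ(g) = tr(σ g)² · det r(g)` pointwise, in the simultaneous normal form
`σ(g₅) = diag(l₁, l₂)`, `σ(s) = b W`, `r(g₅) = ε₁ σ(g₅)`, `r(s) = ε₂ σ(s)` (`l₁, l₂ ≠ 0`, `l₁ ≠ l₂`,
`l₁² ≠ l₂²`, `b ≠ 0`, `ε₁, ε₂ ≠ 0` arbitrary): (E4', `AdTwist.same_or_flip`) the identity at
`g₅ⁱ q`, `s g₅ⁱ q`, `i = 0, 1, 2`, reads `(l₁ⁱ R₀₀ + l₂ⁱ R₁₁)² det Q = (l₁ⁱ Q₀₀ + l₂ⁱ Q₁₁)² det R`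
(and the antidiagonal twin) for `Q = σ(q)`, `R = r(q)`; with `δ² = det R / det Q` the Vandermonde
sign lemma gives `R = c Q` or `R = c J Q J`, `J = diag(1, -1)`, `c ≠ 0`; (E5') both alternatives are
closed under products and inverses and cover `Γ`, so one of them holds everywhere
(`forall_or_forall_of_forall_or`), and on it the scalars form a character
(`AdTwist.exists_character_of_forall`); whence `AdTwist.exists_twist_of_normal_form` and the
registered closed form `stub_twistOfAdNormalForm`: `r = χ · M σ M⁻¹`, `M ∈ {1, J}`.  No definition,
no named fact.
-/

-- the line's namespace `Summit.Langlands.Langlands.…` (summit = problem = `Langlands`) repeats a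
-- component by design
set_option linter.dupNamespace false

namespace Summit.Langlands.Langlands.Theorems.ArtinWeightRealisationEven

open scoped MatrixGroups Matrix

universe u v

namespace TwistConjugate

namespace AdTwist

variable {A : Type*} [Field A]

/-! ### Scalar bookkeeping -/

/-- Square-root extraction: `k · a² · dZ = k · a₀² · dY` with `dY = dZ · δ²`, `k, dZ ≠ 0`, gives
`a = ± δ a₀` (the target form `p = δ a₀` is supplied by `ring`). -/
theorem sign_of_sq {k a a₀ p dY dZ δ : A} (hk : k ≠ 0) (hdZ : dZ ≠ 0)
    (hδ : dY = dZ * (δ * δ)) (hp : δ * a₀ = p)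
    (h : k * (a ^ 2 * dZ) = k * (a₀ ^ 2 * dY)) : a = p ∨ a = -p := by
  have h1 : a ^ 2 * dZ = a₀ ^ 2 * dY := mul_left_cancel₀ hk h
  have h2 : (a * a - p * p) * dZ = 0 := by
    linear_combination h1 + a₀ ^ 2 * hδ + dZ * (δ * a₀ + p) * hp
  have h3 : a * a = p * p := by
    rw [← sub_eq_zero]
    exact (mul_eq_zero.mp h2).resolve_right hdZ
  exact mul_self_eq_mul_self_iff.mp h3

section NormalForm

variable {Γ : Type u} [Group Γ]

/-- **E4'.**  In the simultaneous normal form (`σ(g₅) = diag(l₁, l₂)`, `σ(s) = b W`,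
`r(g₅) = ε₁ σ(g₅)`, `r(s) = ε₂ σ(s)`, `ε₁, ε₂ ≠ 0` arbitrary), the adjoint trace identity at
`g₅ⁱ q` and `s g₅ⁱ q`, `i = 0, 1, 2`, forces `r(q) = c σ(q)` or `r(q) = c J σ(q) J` with `c ≠ 0`. -/
theorem same_or_flip [IsAlgClosed A] (σ r : Γ →* GL (Fin 2) A)
    (had : ∀ g : Γ, Matrix.trace ((r g : GL (Fin 2) A) : Matrix (Fin 2) (Fin 2) A) ^ 2 *
        Matrix.det ((σ g : GL (Fin 2) A) : Matrix (Fin 2) (Fin 2) A) =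
      Matrix.trace ((σ g : GL (Fin 2) A) : Matrix (Fin 2) (Fin 2) A) ^ 2 *
        Matrix.det ((r g : GL (Fin 2) A) : Matrix (Fin 2) (Fin 2) A))
    {g₅ s : Γ} {l₁ l₂ b ε₁ ε₂ : A} (h1 : l₁ ≠ 0) (h2 : l₂ ≠ 0) (hne : l₁ ≠ l₂)
    (hsq : l₁ ^ 2 ≠ l₂ ^ 2) (hb : b ≠ 0) (hε₁ : ε₁ ≠ 0) (hε₂ : ε₂ ≠ 0)
    (hS5 : ((σ g₅ : GL (Fin 2) A) : Matrix (Fin 2) (Fin 2) A) = !![l₁, 0; 0, l₂])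
    (hSs : ((σ s : GL (Fin 2) A) : Matrix (Fin 2) (Fin 2) A) = !![0, b; b, 0])
    (hR5 : ((r g₅ : GL (Fin 2) A) : Matrix (Fin 2) (Fin 2) A) = ε₁ • !![l₁, 0; 0, l₂])
    (hRs : ((r s : GL (Fin 2) A) : Matrix (Fin 2) (Fin 2) A) = ε₂ • !![0, b; b, 0]) (q : Γ) :
    (∃ c : A, c ≠ 0 ∧ ((r q : GL (Fin 2) A) : Matrix (Fin 2) (Fin 2) A) =
        c • ((σ q : GL (Fin 2) A) : Matrix (Fin 2) (Fin 2) A)) ∨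
    (∃ c : A, c ≠ 0 ∧ ((r q : GL (Fin 2) A) : Matrix (Fin 2) (Fin 2) A) =
        c • (!![(1 : A), 0; 0, -1] * ((σ q : GL (Fin 2) A) : Matrix (Fin 2) (Fin 2) A) *
          !![(1 : A), 0; 0, -1])) := by
  have t0 := had q
  have t1 := had (g₅ * q)
  have t2 := had (g₅ * g₅ * q)
  have u0 := had (s * q)
  have u1 := had (s * g₅ * q)
  have u2 := had (s * g₅ * g₅ * q)
  simp only [map_mul, Units.val_mul, Matrix.det_mul] at t1 t2 u0 u1 u2
  simp only [hS5, hSs, hR5, hRs] at t1 t2 u0 u1 u2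
  set Y := ((r q : GL (Fin 2) A) : Matrix (Fin 2) (Fin 2) A) with hY
  set Z := ((σ q : GL (Fin 2) A) : Matrix (Fin 2) (Fin 2) A) with hZ
  have hdY : Y.det ≠ 0 := ((Matrix.isUnit_iff_isUnit_det _).mp (r q).isUnit).ne_zero
  have hdZ : Z.det ≠ 0 := ((Matrix.isUnit_iff_isUnit_det _).mp (σ q).isUnit).ne_zero
  -- the common square root `δ² = det Y / det Z`
  obtain ⟨δ, hδ'⟩ := IsAlgClosed.exists_eq_mul_self (Y.det / Z.det)
  have hδ : Y.det = Z.det * (δ * δ) := by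
    rw [← hδ', mul_div_cancel₀ _ hdZ]
  have hδ0 : δ ≠ 0 := by
    rintro rfl
    rw [mul_zero, mul_zero] at hδ
    exact hdY hδ
  -- expand the six identities
  simp [Matrix.trace_fin_two, Matrix.det_fin_two_of, Fin.sum_univ_two, Matrix.vecMul,
    dotProduct] at t0 t1 t2 u0 u1 u2
  -- extract the signs
  have e0 : Y 0 0 + Y 1 1 = δ * Z 0 0 + δ * Z 1 1 ∨ Y 0 0 + Y 1 1 = -(δ * Z 0 0 + δ * Z 1 1) :=
    sign_of_sq (k := (1 : A)) (a₀ := Z 0 0 + Z 1 1) one_ne_zero hdZ hδ (by ring)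
      (by linear_combination t0)
  have e1 : l₁ * Y 0 0 + l₂ * Y 1 1 = l₁ * (δ * Z 0 0) + l₂ * (δ * Z 1 1) ∨
      l₁ * Y 0 0 + l₂ * Y 1 1 = -(l₁ * (δ * Z 0 0) + l₂ * (δ * Z 1 1)) :=
    sign_of_sq (k := ε₁ ^ 2 * (l₁ * l₂)) (a₀ := l₁ * Z 0 0 + l₂ * Z 1 1)
      (mul_ne_zero (pow_ne_zero _ hε₁) (mul_ne_zero h1 h2)) hdZ hδ (by ring)
      (by linear_combination t1)
  have e2 : l₁ ^ 2 * Y 0 0 + l₂ ^ 2 * Y 1 1 = l₁ ^ 2 * (δ * Z 0 0) + l₂ ^ 2 * (δ * Z 1 1) ∨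
      l₁ ^ 2 * Y 0 0 + l₂ ^ 2 * Y 1 1 = -(l₁ ^ 2 * (δ * Z 0 0) + l₂ ^ 2 * (δ * Z 1 1)) :=
    sign_of_sq (k := ε₁ ^ 4 * (l₁ * l₂) ^ 2) (a₀ := l₁ ^ 2 * Z 0 0 + l₂ ^ 2 * Z 1 1)
      (mul_ne_zero (pow_ne_zero _ hε₁) (pow_ne_zero _ (mul_ne_zero h1 h2))) hdZ hδ (by ring)
      (by linear_combination t2)
  have f0 : Y 0 1 + Y 1 0 = δ * Z 0 1 + δ * Z 1 0 ∨ Y 0 1 + Y 1 0 = -(δ * Z 0 1 + δ * Z 1 0) :=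
    sign_of_sq (k := ε₂ ^ 2 * b ^ 4) (a₀ := Z 0 1 + Z 1 0)
      (mul_ne_zero (pow_ne_zero _ hε₂) (pow_ne_zero _ hb)) hdZ hδ (by ring)
      (by linear_combination u0)
  have f1 : l₁ * Y 0 1 + l₂ * Y 1 0 = l₁ * (δ * Z 0 1) + l₂ * (δ * Z 1 0) ∨
      l₁ * Y 0 1 + l₂ * Y 1 0 = -(l₁ * (δ * Z 0 1) + l₂ * (δ * Z 1 0)) :=
    sign_of_sq (k := ε₂ ^ 2 * ε₁ ^ 2 * b ^ 4 * (l₁ * l₂)) (a₀ := l₁ * Z 0 1 + l₂ * Z 1 0)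
      (mul_ne_zero (mul_ne_zero (mul_ne_zero (pow_ne_zero _ hε₂) (pow_ne_zero _ hε₁))
        (pow_ne_zero _ hb)) (mul_ne_zero h1 h2)) hdZ hδ (by ring)
      (by linear_combination u1)
  have f2 : l₁ ^ 2 * Y 0 1 + l₂ ^ 2 * Y 1 0 = l₁ ^ 2 * (δ * Z 0 1) + l₂ ^ 2 * (δ * Z 1 0) ∨
      l₁ ^ 2 * Y 0 1 + l₂ ^ 2 * Y 1 0 = -(l₁ ^ 2 * (δ * Z 0 1) + l₂ ^ 2 * (δ * Z 1 0)) :=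
    sign_of_sq (k := ε₂ ^ 2 * ε₁ ^ 4 * b ^ 4 * (l₁ * l₂) ^ 2)
      (a₀ := l₁ ^ 2 * Z 0 1 + l₂ ^ 2 * Z 1 0)
      (mul_ne_zero (mul_ne_zero (mul_ne_zero (pow_ne_zero _ hε₂) (pow_ne_zero _ hε₁))
        (pow_ne_zero _ hb)) (pow_ne_zero _ (mul_ne_zero h1 h2))) hdZ hδ (by ring)
      (by linear_combination u2)
  obtain ⟨η, hη, hu, hv⟩ := sign_lemma h1 h2 hne hsq e0 e1 e2
  obtain ⟨η', hη', hu', hv'⟩ := sign_lemma h1 h2 hne hsq f0 f1 f2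
  rcases hη with rfl | rfl <;> rcases hη' with rfl | rfl
  · refine Or.inl ⟨δ, hδ0, ?_⟩
    ext i j
    fin_cases i <;> fin_cases j <;> simp [hu, hv, hu', hv']
  · refine Or.inr ⟨δ, hδ0, ?_⟩
    rw [J_mul_mul_J]
    ext i j
    fin_cases i <;> fin_cases j <;> simp [hu, hv, hu', hv']
  · refine Or.inr ⟨-δ, neg_ne_zero.mpr hδ0, ?_⟩
    rw [J_mul_mul_J]
    ext i j
    fin_cases i <;> fin_cases j <;> simp [hu, hv, hu', hv']
  · refine Or.inl ⟨-δ, neg_ne_zero.mpr hδ0, ?_⟩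
    ext i j
    fin_cases i <;> fin_cases j <;> simp [hu, hv, hu', hv']

/-- Closure of "`ρ = c · τ`, `c ≠ 0`" under products. -/
theorem same_mul (ρ τ : Γ →* GL (Fin 2) A) {x y : Γ}
    (hx : ∃ c : A, c ≠ 0 ∧ ((ρ x : GL (Fin 2) A) : Matrix (Fin 2) (Fin 2) A) =
      c • ((τ x : GL (Fin 2) A) : Matrix (Fin 2) (Fin 2) A))
    (hy : ∃ c : A, c ≠ 0 ∧ ((ρ y : GL (Fin 2) A) : Matrix (Fin 2) (Fin 2) A) =
      c • ((τ y : GL (Fin 2) A) : Matrix (Fin 2) (Fin 2) A)) :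
    ∃ c : A, c ≠ 0 ∧ ((ρ (x * y) : GL (Fin 2) A) : Matrix (Fin 2) (Fin 2) A) =
      c • ((τ (x * y) : GL (Fin 2) A) : Matrix (Fin 2) (Fin 2) A) := by
  obtain ⟨c, hc, hx⟩ := hx
  obtain ⟨c', hc', hy⟩ := hy
  refine ⟨c * c', mul_ne_zero hc hc', ?_⟩
  rw [map_mul, map_mul, Units.val_mul, Units.val_mul, hx, hy, Matrix.smul_mul, Matrix.mul_smul,
    smul_smul]

/-- Closure of "`ρ = c · τ`, `c ≠ 0`" under inverses. -/
theorem same_inv (ρ τ : Γ →* GL (Fin 2) A) {x : Γ}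
    (hx : ∃ c : A, c ≠ 0 ∧ ((ρ x : GL (Fin 2) A) : Matrix (Fin 2) (Fin 2) A) =
      c • ((τ x : GL (Fin 2) A) : Matrix (Fin 2) (Fin 2) A)) :
    ∃ c : A, c ≠ 0 ∧ ((ρ x⁻¹ : GL (Fin 2) A) : Matrix (Fin 2) (Fin 2) A) =
      c • ((τ x⁻¹ : GL (Fin 2) A) : Matrix (Fin 2) (Fin 2) A) := by
  obtain ⟨c, hc, hx⟩ := hx
  refine ⟨c⁻¹, inv_ne_zero hc, ?_⟩
  have hRR : ((ρ x⁻¹ : GL (Fin 2) A) : Matrix (Fin 2) (Fin 2) A) *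
      ((ρ x : GL (Fin 2) A) : Matrix (Fin 2) (Fin 2) A) = 1 := by
    rw [← Units.val_mul, ← map_mul, inv_mul_cancel, map_one, Units.val_one]
  have hSS : ((τ x : GL (Fin 2) A) : Matrix (Fin 2) (Fin 2) A) *
      ((τ x⁻¹ : GL (Fin 2) A) : Matrix (Fin 2) (Fin 2) A) = 1 := by
    rw [← Units.val_mul, ← map_mul, mul_inv_cancel, map_one, Units.val_one]
  have hSx : ((τ x : GL (Fin 2) A) : Matrix (Fin 2) (Fin 2) A) =
      c⁻¹ • ((ρ x : GL (Fin 2) A) : Matrix (Fin 2) (Fin 2) A) := by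
    rw [hx, smul_smul, inv_mul_cancel₀ hc, one_smul]
  calc ((ρ x⁻¹ : GL (Fin 2) A) : Matrix (Fin 2) (Fin 2) A)
      = ((ρ x⁻¹ : GL (Fin 2) A) : Matrix (Fin 2) (Fin 2) A) *
          (((τ x : GL (Fin 2) A) : Matrix (Fin 2) (Fin 2) A) *
            ((τ x⁻¹ : GL (Fin 2) A) : Matrix (Fin 2) (Fin 2) A)) := by rw [hSS, Matrix.mul_one]
    _ = c⁻¹ • ((τ x⁻¹ : GL (Fin 2) A) : Matrix (Fin 2) (Fin 2) A) := by
        rw [hSx, Matrix.smul_mul, Matrix.mul_smul, ← Matrix.mul_assoc, hRR, Matrix.one_mul]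

/-- From "`ρ(q) = c_q τ(q)`, `c_q ≠ 0`, for every `q`" to a character `χ` with `ρ = χ τ`. -/
theorem exists_character_of_forall (τ ρ : Γ →* GL (Fin 2) A)
    (h : ∀ q, ∃ c : A, c ≠ 0 ∧ ((ρ q : GL (Fin 2) A) : Matrix (Fin 2) (Fin 2) A) =
      c • ((τ q : GL (Fin 2) A) : Matrix (Fin 2) (Fin 2) A)) :
    ∃ χ : Γ →* Aˣ, ∀ g, ((ρ g : GL (Fin 2) A) : Matrix (Fin 2) (Fin 2) A) =
      ((χ g : Aˣ) : A) • ((τ g : GL (Fin 2) A) : Matrix (Fin 2) (Fin 2) A) := by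
  choose f hf0 hf using h
  have hdetS : ∀ q, ((τ q : GL (Fin 2) A) : Matrix (Fin 2) (Fin 2) A).det ≠ 0 := fun q =>
    ((Matrix.isUnit_iff_isUnit_det _).mp (τ q).isUnit).ne_zero
  have hmul : ∀ x y, f (x * y) = f x * f y := by
    intro x y
    apply smul_left_cancel_of_det_ne_zero (hdetS (x * y))
    rw [← hf (x * y), map_mul ρ, Units.val_mul, hf x, hf y, Matrix.smul_mul, Matrix.mul_smul,
      smul_smul, map_mul τ, Units.val_mul]
  refine ⟨MonoidHom.mk' (fun q => Units.mk0 (f q) (hf0 q)) ?_, ?_⟩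
  · intro x y
    ext
    simp [hmul]
  · intro g
    simp only [MonoidHom.mk'_apply, Units.val_mk0]
    exact hf g

/-- **E4' + E5'.**  In the simultaneous normal form, the adjoint trace identity forces
`r = χ · M σ M⁻¹` with `M ∈ {1, J}`. -/
theorem exists_twist_of_normal_form [IsAlgClosed A] (σ r : Γ →* GL (Fin 2) A)
    (had : ∀ g : Γ, Matrix.trace ((r g : GL (Fin 2) A) : Matrix (Fin 2) (Fin 2) A) ^ 2 *
        Matrix.det ((σ g : GL (Fin 2) A) : Matrix (Fin 2) (Fin 2) A) =
      Matrix.trace ((σ g : GL (Fin 2) A) : Matrix (Fin 2) (Fin 2) A) ^ 2 *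
        Matrix.det ((r g : GL (Fin 2) A) : Matrix (Fin 2) (Fin 2) A))
    {g₅ s : Γ} {l₁ l₂ b ε₁ ε₂ : A} (h1 : l₁ ≠ 0) (h2 : l₂ ≠ 0) (hne : l₁ ≠ l₂)
    (hsq : l₁ ^ 2 ≠ l₂ ^ 2) (hb : b ≠ 0) (hε₁ : ε₁ ≠ 0) (hε₂ : ε₂ ≠ 0)
    (hS5 : ((σ g₅ : GL (Fin 2) A) : Matrix (Fin 2) (Fin 2) A) = !![l₁, 0; 0, l₂])
    (hSs : ((σ s : GL (Fin 2) A) : Matrix (Fin 2) (Fin 2) A) = !![0, b; b, 0])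
    (hR5 : ((r g₅ : GL (Fin 2) A) : Matrix (Fin 2) (Fin 2) A) = ε₁ • !![l₁, 0; 0, l₂])
    (hRs : ((r s : GL (Fin 2) A) : Matrix (Fin 2) (Fin 2) A) = ε₂ • !![0, b; b, 0]) :
    ∃ (χ : Γ →* Aˣ) (M : GL (Fin 2) A),
      ∀ g : Γ, ((r g : GL (Fin 2) A) : Matrix (Fin 2) (Fin 2) A) =
        ((χ g : Aˣ) : A) • ((M * σ g * M⁻¹ : GL (Fin 2) A) : Matrix (Fin 2) (Fin 2) A) := by
  have hJdet : (!![(1 : A), 0; 0, -1] : Matrix (Fin 2) (Fin 2) A).det ≠ 0 := by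
    simp [Matrix.det_fin_two_of]
  set J : GL (Fin 2) A := Matrix.GeneralLinearGroup.mkOfDetNeZero _ hJdet with hJ
  have hJval : ((J : GL (Fin 2) A) : Matrix (Fin 2) (Fin 2) A) = !![(1 : A), 0; 0, -1] := rfl
  have hJJ : J * J = 1 := by
    ext : 1
    rw [Units.val_mul, hJval, J_mul_J, Units.val_one]
  have hJinv : J⁻¹ = J := inv_eq_of_mul_eq_one_right hJJ
  set σ' : Γ →* GL (Fin 2) A := (MulAut.conj J).toMonoidHom.comp σ with hσ'def
  have hσ' : ∀ q, ((σ' q : GL (Fin 2) A) : Matrix (Fin 2) (Fin 2) A) =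
      !![(1 : A), 0; 0, -1] * ((σ q : GL (Fin 2) A) : Matrix (Fin 2) (Fin 2) A) *
        !![(1 : A), 0; 0, -1] := by
    intro q
    change (((J * σ q * J⁻¹ : GL (Fin 2) A)) : Matrix (Fin 2) (Fin 2) A) = _
    rw [hJinv, Units.val_mul, Units.val_mul, hJval]
  have hdich := same_or_flip σ r had h1 h2 hne hsq hb hε₁ hε₂ hS5 hSs hR5 hRs
  have key := forall_or_forall_of_forall_or
    (P := fun q => ∃ c : A, c ≠ 0 ∧ ((r q : GL (Fin 2) A) : Matrix (Fin 2) (Fin 2) A) =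
      c • ((σ q : GL (Fin 2) A) : Matrix (Fin 2) (Fin 2) A))
    (Q := fun q => ∃ c : A, c ≠ 0 ∧ ((r q : GL (Fin 2) A) : Matrix (Fin 2) (Fin 2) A) =
      c • ((σ' q : GL (Fin 2) A) : Matrix (Fin 2) (Fin 2) A))
    (fun x y hx hy => same_mul r σ hx hy) (fun x hx => same_inv r σ hx)
    (fun x y hx hy => same_mul r σ' hx hy) (fun x hx => same_inv r σ' hx)
    (fun x => (hdich x).imp id (fun ⟨c, hc, e⟩ => ⟨c, hc, by rw [hσ', e]⟩))
  rcases key with hall | hall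
  · obtain ⟨χ, hr⟩ := exists_character_of_forall σ r hall
    refine ⟨χ, 1, fun g => ?_⟩
    rw [hr g, one_mul, inv_one, mul_one]
  · obtain ⟨χ, hr⟩ := exists_character_of_forall σ' r hall
    refine ⟨χ, J, fun g => ?_⟩
    rw [hr g]
    rfl

end NormalForm

end AdTwist

end TwistConjugate

open TwistConjugate AdTwist in
/-- Registered sub-goal S4ad-twist (closed form of `AdTwist.exists_twist_of_normal_form`): in the
simultaneous normal form the adjoint trace identity `tr(r g)² det σ(g) = tr(σ g)² det r(g)` forces
`r = χ · M σ M⁻¹` for a character `χ : Γ → Aˣ`. -/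
theorem stub_twistOfAdNormalForm :
    ∀ (Γ : Type u) [Group Γ] (A : Type v) [Field A] [IsAlgClosed A] [CharZero A] (σ r : Γ →* GL (Fin 2) A), (∀ g : Γ, Matrix.trace ((r g : GL (Fin 2) A) : Matrix (Fin 2) (Fin 2) A) ^ 2 * Matrix.det ((σ g : GL (Fin 2) A) : Matrix (Fin 2) (Fin 2) A) = Matrix.trace ((σ g : GL (Fin 2) A) : Matrix (Fin 2) (Fin 2) A) ^ 2 * Matrix.det ((r g : GL (Fin 2) A) : Matrix (Fin 2) (Fin 2) A)) → ∀ (g₅ s : Γ) (l₁ l₂ b ε₁ ε₂ : A), l₁ ≠ 0 → l₂ ≠ 0 → l₁ ≠ l₂ → l₁ ^ 2 ≠ l₂ ^ 2 → b ≠ 0 → ε₁ ≠ 0 → ε₂ ≠ 0 → ((σ g₅ : GL (Fin 2) A) : Matrix (Fin 2) (Fin 2) A) = !![l₁, 0; 0, l₂] → ((σ s : GL (Fin 2) A) : Matrix (Fin 2) (Fin 2) A) = !![0, b; b, 0] → ((r g₅ : GL (Fin 2) A) : Matrix (Fin 2) (Fin 2) A) = ε₁ • !![l₁, 0; 0, l₂]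 → ((r s : GL (Fin 2) A) : Matrix (Fin 2) (Fin 2) A) = ε₂ • !![0, b; b, 0] → ∃ (χ : Γ →* Aˣ) (M : GL (Fin 2) A), ∀ g : Γ, ((r g : GL (Fin 2) A) : Matrix (Fin 2) (Fin 2) A) = ((χ g : Aˣ) : A) • ((M * σ g * M⁻¹ : GL (Fin 2) A) : Matrix (Fin 2) (Fin 2) A) :=
  fun _ _ _ _ _ _ σ r had _ _ _ _ _ _ _ h1 h2 hne hsq hb hε₁ hε₂ hS5 hSs hR5 hRs =>
    exists_twist_of_normal_form σ r had h1 h2 hne hsq hb hε₁ hε₂ hS5 hSs hR5 hRs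

end Summit.Langlands.Langlands.Theorems.ArtinWeightRealisationEven
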